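import Summits.CriticalPhenomena.PercolationContinuityZ3.Theorems.FK.TranslationAveragesFK
import Summits.CriticalPhenomena.PercolationContinuityZ3.Theorems.FK.ClusterDensityCriterion
import HarnessLib

/-!
# FK-continuity cell, FO-10a: the density of sites in infinite open clusters is `θ^b(p,q)` —
# `|Λ|⁻¹ #{x ∈ Λ : x ↔ ∞} → θ^b(p,q)` in `L¹(φ^b_{p,q})` and in `φ^b_{p,q}`-probability along every `|Λ_i| → ∞`

Registered R111 (cell INBOX l.7597, 2026-08-25); registry row FO-10a-g342; label LLN-D (coordinator fk-4 g228).
Cell `fk-continuity` (bschramm), row FO-10a (pressure layer); support file for the FK-continuity transplant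
(`--supports stmt-CriticalPhenomena-4575`); builds on p205010 (kernel theorem, internal audit signed; external expert
review pending). Pure proofs; no definitions, no named facts, no sorries; `0 ≤ p ≤ 1`, `q ≥ 1`, both boundary
conditions `b`, every `d` (`d ≥ 1` along boxes). UNCONDITIONAL infinite-volume structure; it decides nothing about
FH / TP_FK / the value of `p_c(q)` or of `θ^b(p_c(q), q)`.

The percolation probability `θ^b(p,q) = φ^b_{p,q}(0 ↔ ∞)` (Grimmett 2006, (5.1); the tree's `thetaFree` / `thetaWired`,
identified with `(rcLimit d b p q)(percolatesAt 0)` in `ClusterDensityCriterion.lean`) is also the asymptotic DENSITY of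
the sites lying in infinite open clusters — for Bernoulli percolation this is Grimmett 1999, §7.4 (7.100)–(7.102) "by the
ergodic theorem" (the tree's `Literature…InfiniteClusterDensity.lean` proves an a.s. lower bound there by Efron–Stein,
Bernoulli only). Here, for the random-cluster measures `φ^b_{p,q}`: the indicator of `{0 ↔ ∞}` is within
`φ^b(|C_0| ≥ k) − θ^b → 0` in `L¹` of the indicator of `{|C_0| ≥ k}`, which is a.e. local and hence self-mixing
(`TranslationAveragesFK.lean`), so the `L¹` law of large numbers of `TranslationAverages.lean` applies:

* `preimage_relabel_shift_neg_percolatesAt_zero` — `{ω : ω − x ∈ {0 ↔ ∞}} = {x ↔ ∞}`;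
* **`tendsto_integral_abs_density_percolatesAt_sub_theta`** — for all finite `Λ_i ⊆ ℤ^d` with `|Λ_i| → ∞`:
  `∫ | |Λ_i|⁻¹ Σ_{x∈Λ_i} 1{x ↔ ∞} − θ^b(p,q) | dφ^b_{p,q} → 0`;
* **`tendsto_rcLimit_real_le_abs_density_percolatesAt_sub_theta`** — in probability:
  `φ^b_{p,q}(| |Λ_i|⁻¹ #{x ∈ Λ_i : x ↔ ∞} − θ^b(p,q) | ≥ δ) → 0` for every `δ > 0`; box versions (`d ≥ 1`).

## References

* G. Grimmett, *The Random-Cluster Model*, Springer 2006 (`book:grimmett2006-random-cluster-model`): §4.3 Cor. (4.23)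
  [PDF p. 79]; §5.1 (5.1)–(5.3) [PDF p. 98]. [Grimmett2006]
* G. Grimmett, *Percolation*, 2nd ed., Springer 1999: §7.4, (7.100)–(7.102) (density of the infinite cluster by the
  ergodic theorem). [GrimmettPercolation1999]
-/

noncomputable section

open MeasureTheory Set Filter Finset
open scoped Topology ENNReal

namespace Summit.CriticalPhenomena.PercolationContinuityZ3.Theorems.FK

open Literature.Probability.Percolation Literature.Probability.LatticeModels
open Literature.Barriers.CriticalPhenomena (thetaWired)

variable {d : ℕ} {p q : ℝ}

/-- **`{ω : ω − x ∈ {0 ↔ ∞}} = {x ↔ ∞}`**: translating by `−x` carries the infinite cluster of `x` to one of the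
origin. [cite: Grimmett2006, §4.3 (translations τ_x)] -/
theorem preimage_relabel_shift_neg_percolatesAt_zero (x : Site d) :
    BondConfig.relabel (sym2Equiv (Site.shift (-x))) ⁻¹' (percolatesAt (0 : Site d) : Set (BondConfig (Site d))) =
      percolatesAt x := by
  have h := preimage_relabel_shift_percolatesAt (-x) x
  rwa [add_neg_cancel] at h

/-- The `L¹` distance between the indicators of `{|C_0| ≥ k} ⊇ {0 ↔ ∞}` is `φ^b(|C_0| ≥ k) − θ^b`, which tends to `0`:
for every `ε > 0` some `k` has `∫ |1{0 ↔ ∞} − 1{|C_0| ≥ k}| dφ^b_{p,q} ≤ ε`. [cite: Grimmett2006, §5.1 (5.1)] -/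
theorem exists_integral_abs_indicator_percolatesAt_sub_le (b : Bool) (p q : ℝ) {ε : ℝ} (hε : 0 < ε) :
    ∃ k : ℕ, ∫ ω, |(percolatesAt (0 : Site d)).indicator (1 : BondConfig (Site d) → ℝ) ω -
        (clusterSizeGe (0 : Site d) k).indicator (1 : BondConfig (Site d) → ℝ) ω| ∂(rcLimit d b p q) ≤ ε := by
  haveI := isProbabilityMeasure_rcLimit (d := d) b p q
  have hperc : MeasurableSet (percolatesAt (0 : Site d) : Set (BondConfig (Site d))) :=
    measurableSet_percolatesAt_holds _
  obtain ⟨k, hk⟩ := (Metric.tendsto_atTop.1 (tendsto_rcLimit_real_clusterSizeGe b p q (0 : Site d) (d := d))) ε hε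
  refine ⟨k, ?_⟩
  have hsub := percolatesAt_subset_clusterSizeGe (0 : Site d) k (V := Site d)
  have hpt : ∀ ω : BondConfig (Site d), |(percolatesAt (0 : Site d)).indicator (1 : BondConfig (Site d) → ℝ) ω -
      (clusterSizeGe (0 : Site d) k).indicator (1 : BondConfig (Site d) → ℝ) ω| =
      (clusterSizeGe (0 : Site d) k).indicator (1 : BondConfig (Site d) → ℝ) ω -
        (percolatesAt (0 : Site d)).indicator (1 : BondConfig (Site d) → ℝ) ω := fun ω => by
    have hle : (percolatesAt (0 : Site d)).indicator (1 : BondConfig (Site d) → ℝ) ω ≤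
        (clusterSizeGe (0 : Site d) k).indicator (1 : BondConfig (Site d) → ℝ) ω :=
      Set.indicator_le_indicator_of_subset hsub (fun _ => zero_le_one) ω
    rw [abs_sub_comm, abs_of_nonneg (sub_nonneg.2 hle)]
  have hi1 : Integrable ((clusterSizeGe (0 : Site d) k).indicator (1 : BondConfig (Site d) → ℝ)) (rcLimit d b p q) :=
    (integrable_const (1 : ℝ)).indicator (measurableSet_clusterSizeGe _ _)
  have hi2 : Integrable ((percolatesAt (0 : Site d)).indicator (1 : BondConfig (Site d) → ℝ)) (rcLimit d b p q) :=
    (integrable_const (1 : ℝ)).indicator hperc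
  simp_rw [hpt]
  rw [integral_sub hi1 hi2, integral_indicator_one (measurableSet_clusterSizeGe _ _), integral_indicator_one hperc]
  have h := hk k le_rfl
  rw [Real.dist_eq] at h
  exact (le_abs_self _).trans h.le

/-- **The density of sites in infinite clusters, `L¹` form**: for `b ∈ {0,1}`, `0 ≤ p ≤ 1`, `q ≥ 1` and all finite
`Λ_i ⊆ ℤ^d` with `|Λ_i| → ∞`, `∫ | |Λ_i|⁻¹ Σ_{x∈Λ_i} 1{x ↔ ∞} − θ^b(p,q) | dφ^b_{p,q} → 0`.
[cite: Grimmett2006, §5.1 (5.1) with Cor. (4.23)] -/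
theorem tendsto_integral_abs_density_percolatesAt_sub_theta (b : Bool) (hp : p ∈ Set.Icc (0 : ℝ) 1) (hq : 1 ≤ q)
    {ι : Type*} {l : Filter ι} {Λ : ι → Finset (Site d)} (hΛ : Tendsto (fun i => (#(Λ i) : ℝ)) l atTop) :
    Tendsto (fun i => ∫ ω, |(#(Λ i) : ℝ)⁻¹ *
        ∑ x ∈ Λ i, (percolatesAt x : Set (BondConfig (Site d))).indicator (1 : BondConfig (Site d) → ℝ) ω -
        (bif b then thetaWired d p q else thetaFree d p q)| ∂(rcLimit d b p q)) l (𝓝 0) := by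
  haveI := isProbabilityMeasure_rcLimit (d := d) b p q
  have hperc : MeasurableSet (percolatesAt (0 : Site d) : Set (BondConfig (Site d))) :=
    measurableSet_percolatesAt_holds _
  have h := tendsto_integral_abs_avg_sub_integral (T := fun v => ⇑(BondConfig.relabel (sym2Equiv (Site.shift (-v)))))
    (P := rcLimit d b p q) (fun v => (BondConfig.relabel _).measurable) relabel_shift_neg_relabel_shift_neg_apply
    ((isBoxLimit_rcLimit b hp hq).measurePreserving_relabel_shift hp hq <| -·)
    (f := (percolatesAt (0 : Site d)).indicator (1 : BondConfig (Site d) → ℝ)) (measurable_const.indicator hperc)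
    (M := 1) (fun ω => (Real.norm_eq_abs _).symm.trans_le ((norm_indicator_le_norm_self _ _).trans norm_one.le))
    (fun ε hε => ?_) hΛ
  · rw [integral_indicator_one hperc, rcLimit_real_percolatesAt b hp hq] at h
    have hfun : ∀ (ω : BondConfig (Site d)) (x : Site d), (percolatesAt (0 : Site d)).indicator
        (1 : BondConfig (Site d) → ℝ) (BondConfig.relabel (sym2Equiv (Site.shift (-x))) ω) =
        (percolatesAt x : Set (BondConfig (Site d))).indicator (1 : BondConfig (Site d) → ℝ) ω := fun ω x => by
      rw [← preimage_relabel_shift_neg_percolatesAt_zero x]; rfl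
    simp_rw [hfun] at h
    exact h
  obtain ⟨k, hk⟩ := exists_integral_abs_indicator_percolatesAt_sub_le b p q hε (d := d)
  refine ⟨{k}, fun _ => 1, fun j => clusterSizeGe (0 : Site d) j, fun j _ => ⟨measurableSet_clusterSizeGe _ _, ?_⟩, ?_⟩
  · exact tendsto_rcLimit_real_inter_preimage_shift_neg_of_ae_eq b hp hq
      ⟨_, determinedBy_le_encard_openCluster_inter (0 : Site d) 0 j⟩ (clusterSizeGe_ae_eq_local b hp hq j)
  · simpa only [Finset.sum_singleton, one_mul] using hk

/-- **The density of sites in infinite clusters, in probability**: for every `δ > 0`,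
`φ^b_{p,q}(| |Λ_i|⁻¹ Σ_{x∈Λ_i} 1{x ↔ ∞} − θ^b(p,q) | ≥ δ) → 0` (`|Λ_i| → ∞`).
[cite: Grimmett2006, §5.1 (5.1) with Cor. (4.23)] -/
theorem tendsto_rcLimit_real_le_abs_density_percolatesAt_sub_theta (b : Bool) (hp : p ∈ Set.Icc (0 : ℝ) 1)
    (hq : 1 ≤ q) {ι : Type*} {l : Filter ι} {Λ : ι → Finset (Site d)}
    (hΛ : Tendsto (fun i => (#(Λ i) : ℝ)) l atTop) {δ : ℝ} (hδ : 0 < δ) :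
    Tendsto (fun i => (rcLimit d b p q).real {ω | δ ≤ |(#(Λ i) : ℝ)⁻¹ *
        ∑ x ∈ Λ i, (percolatesAt x : Set (BondConfig (Site d))).indicator (1 : BondConfig (Site d) → ℝ) ω -
        (bif b then thetaWired d p q else thetaFree d p q)|}) l (𝓝 0) := by
  haveI := isProbabilityMeasure_rcLimit (d := d) b p q
  refine tendsto_measureReal_le_abs_of_integral (fun i => ?_)
    (tendsto_integral_abs_density_percolatesAt_sub_theta b hp hq hΛ) hδ
  exact ((integrable_finsetSum _ fun x _ => (integrable_const (1 : ℝ)).indicator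
    (measurableSet_percolatesAt_holds x)).const_mul _).sub (integrable_const _)

/-- **Along boxes, `L¹`**: `∫ | |Λ_n|⁻¹ #{x ∈ Λ_n : x ↔ ∞} − θ^b(p,q) | dφ^b_{p,q} → 0` (`d ≥ 1`).
[cite: Grimmett2006, §5.1 (5.1) with Cor. (4.23)] -/
theorem tendsto_integral_abs_density_percolatesAt_box_sub_theta (hd : 0 < d) (b : Bool)
    (hp : p ∈ Set.Icc (0 : ℝ) 1) (hq : 1 ≤ q) :
    Tendsto (fun n : ℕ => ∫ ω, |(#(box d n) : ℝ)⁻¹ *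
        ∑ x ∈ box d n, (percolatesAt x : Set (BondConfig (Site d))).indicator (1 : BondConfig (Site d) → ℝ) ω -
        (bif b then thetaWired d p q else thetaFree d p q)| ∂(rcLimit d b p q)) atTop (𝓝 0) :=
  tendsto_integral_abs_density_percolatesAt_sub_theta b hp hq (tendsto_natCast_card_box_atTop hd)

/-- **Along boxes, in probability**: `φ^b_{p,q}(| |Λ_n|⁻¹ #{x ∈ Λ_n : x ↔ ∞} − θ^b(p,q) | ≥ δ) → 0` (`d ≥ 1`, `δ > 0`).
[cite: Grimmett2006, §5.1 (5.1) with Cor. (4.23)] -/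
theorem tendsto_rcLimit_real_le_abs_density_percolatesAt_box_sub_theta (hd : 0 < d) (b : Bool)
    (hp : p ∈ Set.Icc (0 : ℝ) 1) (hq : 1 ≤ q) {δ : ℝ} (hδ : 0 < δ) :
    Tendsto (fun n : ℕ => (rcLimit d b p q).real {ω | δ ≤ |(#(box d n) : ℝ)⁻¹ *
        ∑ x ∈ box d n, (percolatesAt x : Set (BondConfig (Site d))).indicator (1 : BondConfig (Site d) → ℝ) ω -
        (bif b then thetaWired d p q else thetaFree d p q)|}) atTop (𝓝 0) :=
  tendsto_rcLimit_real_le_abs_density_percolatesAt_sub_theta b hp hq (tendsto_natCast_card_box_atTop hd) hδ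

end Summit.CriticalPhenomena.PercolationContinuityZ3.Theorems.FK

end
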